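import Summits.QuantumAdvantage.QuantumAdvantage.Theorems.CubicForrelationNearExactIsExactWalshTower
import Summits.QuantumAdvantage.QuantumAdvantage.Theorems.CubicForrelationNearExactIsExactAxParity
import Summits.QuantumAdvantage.QuantumAdvantage.Theorems.CubicForrelationNearExactIsExactValueGranularity

/-!
# Crux `CubicForrelation.NearExactIsExact` (stmt-QuantumAdvantage-14043), line `direct-sum-amplification`, lead c6 cycle 2 (wave 3):
  stub `stub_tenPeel` — peeling a 10-bit function of balanced-split normal form along its last two coordinates

If `g(w ‖ a ‖ b) = E(w) ⊕ (a ∧ D w) ⊕ (b ∧ (a ⊕ Q w))` (`Fin.snoc` twice: `w ∈ 𝔽₂⁸`, then `a`, then `b`), then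
`W_g(x ‖ a ‖ b) = 2·(−1)^{ab}·W_{G[a,b]}(x)` with `G[a,b] = E ⊕ QD ⊕ aQ ⊕ bD`, and `Φ(f,g) = ¼ Σ_{a,b} Φ₈(f(· ‖ a ‖ b) ⊕ ab, G[a,b])`.
Used by the lead as the bridge from the 10-bit window to the 8-bit endgame of the balanced split.

Proof. Split the sum over `y ∈ 𝔽₂¹⁰` along the last two coordinates (`SgnForrMem.sum_snoc` twice), factor the
character (`twist_snoc` twice: `(−1)^{(x‖a‖b)·(w‖a₀‖b₀)} = (−1)^{x·w} (−1)^{a a₀} (−1)^{b b₀}`), and evaluate the sum over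
`(a₀, b₀) ∈ 𝔽₂²` in closed form (`tp_bool_sum`, a 32-case Boolean identity: the `b₀`-sum is `2·[a₀ = Q w ⊕ b]`, and
substituting `a₀` gives `(−1)^{ab} (−1)^{E ⊕ QD ⊕ aQ ⊕ bD}`).  The forrelation identity follows from
`√(2^{3n}) Φ(f,g) = Σ_x (−1)^{f(x)} W_g(x)` (`fsum_signOf_eq`, `fsum_eq_sum_mul_W`) at `n = 10` and `n = 8`
(`√(2^{30}) = 2^{15}`, `√(2^{24}) = 2^{12}`), the same splitting of the `x`-sum, and `2 · 2^{12} / 2^{15} = 1/4`.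
Sources: S. Aaronson, A. Ambainis, *Forrelation*, SIAM J. Comput. 47 (2018) §1.1.1 (normalisation of `Φ`);
R. O'Donnell, *Analysis of Boolean Functions*, CUP 2014, §1.4 (characters factor over coordinates). Everything below is
proved from Mathlib and the tree (`W`, `fsum_signOf_eq`, `fsum_eq_sum_mul_W`, `SgnForrMem.sum_snoc`, `twist_snoc`, `signOf_xor`);
axioms are the standard three.
-/

set_option linter.dupNamespace false -- D-0017: single-problem summit ⇒ `QuantumAdvantage.QuantumAdvantage` by design

noncomputable section

namespace Summit.QuantumAdvantage.QuantumAdvantage.Theorems.CubicForrelation.NearExactIsExact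

open Finset
open Literature.Computability.QuantumComplexity
open Literature.Computability.QuantumComplexity.DerivativeWalsh (W fsum_eq_sum_mul_W fsum_signOf_eq)

/-! ### The two-bit character sum -/

/-- The closed form of the sum over the last two bits: for Booleans `e d q a b` and a real weight `t`,
`Σ_{a₀ b₀} (−1)^{e ⊕ a₀d ⊕ b₀(a₀ ⊕ q)} · t (−1)^{a₀ a} (−1)^{b₀ b} = 2 (−1)^{ab} (−1)^{e ⊕ qd ⊕ aq ⊕ bd} t`
(the `b₀`-sum is `2·[a₀ = q ⊕ b]`). -/
theorem tp_bool_sum (e d q a b : Bool) (t : ℝ) :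
    ∑ a₀ : Bool, ∑ b₀ : Bool,
        signOf (e ^^ (a₀ && d) ^^ (b₀ && (a₀ ^^ q))) * (t * signOf (a₀ && a) * signOf (b₀ && b)) =
      2 * signOf (a && b) * (signOf (e ^^ (q && d) ^^ (a && q) ^^ (b && d)) * t) := by
  simp only [Fintype.sum_bool]
  cases e <;> cases d <;> cases q <;> cases a <;> cases b <;> norm_num [signOf] <;> ring

/-! ### The Walsh transform of the peeled function -/

/-- **Walsh peel.** If `g(w ‖ a₀ ‖ b₀) = E(w) ⊕ (a₀ ∧ D w) ⊕ (b₀ ∧ (a₀ ⊕ Q w))` then for every `x ∈ 𝔽₂⁸` and bits `a b`,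
`W_g(x ‖ a ‖ b) = 2 (−1)^{ab} W_{E ⊕ QD ⊕ aQ ⊕ bD}(x)`. -/
theorem tp_W_peel (E D Q : (Fin (4 + 4) → Bool) → Bool) (g : (Fin (4 + 4 + 1 + 1) → Bool) → Bool)
    (hg : ∀ (w : Fin (4 + 4) → Bool) (a b : Bool),
      g (Fin.snoc (Fin.snoc w a) b) = (E w ^^ (a && D w) ^^ (b && (a ^^ Q w))))
    (x : Fin (4 + 4) → Bool) (a b : Bool) :
    W (fun y => signOf (g y)) (Fin.snoc (Fin.snoc x a) b) =
      2 * signOf (a && b) * W (fun w => signOf (E w ^^ (Q w && D w) ^^ (a && Q w) ^^ (b && D w))) x := by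
  unfold W
  rw [SgnForrMem.sum_snoc (m := 4 + 4 + 1), SgnForrMem.sum_snoc (m := 4 + 4), mul_sum]
  refine sum_congr rfl fun w _ => ?_
  simp only [hg, twist_snoc]
  exact tp_bool_sum (E w) (D w) (Q w) a b (twist w x)

/-! ### The forrelation of the peeled pair -/

/-- `√(2^{3n}) Φ(f,g) = Σ_x (−1)^{f(x)} W_g(x)` (`fsum_signOf_eq` with `fsum_eq_sum_mul_W`). -/
theorem tp_sqrt_mul_forrelation {n : ℕ} (f g : (Fin n → Bool) → Bool) :
    Real.sqrt ((2 : ℝ) ^ (3 * n)) * forrelation f g = ∑ x, signOf (f x) * W (fun y => signOf (g y)) x := by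
  rw [← fsum_signOf_eq, fsum_eq_sum_mul_W]

/-- Reordering a triple sum: `Σ_x Σ_a Σ_b = Σ_a Σ_b Σ_x`. -/
theorem tp_sum_comm₃ {α β γ : Type*} [Fintype α] [Fintype β] [Fintype γ] (T : α → β → γ → ℝ) :
    ∑ x, ∑ a, ∑ b, T x a b = ∑ a, ∑ b, ∑ x, T x a b := by
  rw [sum_comm]
  exact sum_congr rfl fun a _ => sum_comm

/-- **Forrelation peel.** If `g(w ‖ a₀ ‖ b₀) = E(w) ⊕ (a₀ ∧ D w) ⊕ (b₀ ∧ (a₀ ⊕ Q w))` then for every `f` on `10` bits,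
`Φ(f,g) = ¼ Σ_{a,b} Φ₈(f(· ‖ a ‖ b) ⊕ ab, E ⊕ QD ⊕ aQ ⊕ bD)`. -/
theorem tp_forrelation_peel (E D Q : (Fin (4 + 4) → Bool) → Bool) (f g : (Fin (4 + 4 + 1 + 1) → Bool) → Bool)
    (hg : ∀ (w : Fin (4 + 4) → Bool) (a b : Bool),
      g (Fin.snoc (Fin.snoc w a) b) = (E w ^^ (a && D w) ^^ (b && (a ^^ Q w)))) :
    forrelation f g = (1 / 4) * ∑ a : Bool, ∑ b : Bool,
      forrelation (fun x : Fin (4 + 4) → Bool => f (Fin.snoc (Fin.snoc x a) b) ^^ (a && b))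
        (fun w => E w ^^ (Q w && D w) ^^ (a && Q w) ^^ (b && D w)) := by
  have hs10 : Real.sqrt ((2 : ℝ) ^ (3 * (4 + 4 + 1 + 1))) = 2 ^ 15 := by
    rw [show (2 : ℝ) ^ (3 * (4 + 4 + 1 + 1)) = ((2 : ℝ) ^ 15) ^ 2 by norm_num, Real.sqrt_sq (by positivity)]
  have hs8 : Real.sqrt ((2 : ℝ) ^ (3 * (4 + 4))) = 2 ^ 12 := by
    rw [show (2 : ℝ) ^ (3 * (4 + 4)) = ((2 : ℝ) ^ 12) ^ 2 by norm_num, Real.sqrt_sq (by positivity)]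
  -- the 10-bit scaled forrelation, split along the last two coordinates of `x`
  have h10 := tp_sqrt_mul_forrelation f g
  rw [hs10, SgnForrMem.sum_snoc (m := 4 + 4 + 1), SgnForrMem.sum_snoc (m := 4 + 4)] at h10
  simp only [tp_W_peel E D Q g hg] at h10
  -- the 8-bit scaled forrelations of the slices
  have h8 : ∀ a b : Bool,
      forrelation (fun x : Fin (4 + 4) → Bool => f (Fin.snoc (Fin.snoc x a) b) ^^ (a && b))
        (fun w => E w ^^ (Q w && D w) ^^ (a && Q w) ^^ (b && D w)) =
      ((2 : ℝ) ^ 12)⁻¹ * ∑ x : Fin (4 + 4) → Bool, signOf (f (Fin.snoc (Fin.snoc x a) b)) * signOf (a && b) *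
        W (fun w => signOf (E w ^^ (Q w && D w) ^^ (a && Q w) ^^ (b && D w))) x := by
    intro a b
    rw [eq_inv_mul_iff_mul_eq₀ (by positivity), ← hs8, tp_sqrt_mul_forrelation]
    simp only [signOf_xor]
  apply mul_left_cancel₀ (show (2 : ℝ) ^ 15 ≠ 0 by positivity)
  rw [h10, tp_sum_comm₃]
  simp only [h8, mul_sum]
  refine sum_congr rfl fun a _ => sum_congr rfl fun b _ => sum_congr rfl fun x _ => ?_
  ring

/-! ### The stub -/

/-- **Peeling a 10-bit function of balanced-split normal form along its last two coordinates.**  If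
`g(w ‖ a ‖ b) = E(w) ⊕ (a ∧ D w) ⊕ (b ∧ (a ⊕ Q w))` then `W_g(x ‖ a ‖ b) = 2(−1)^{ab} W_{E ⊕ QD ⊕ aQ ⊕ bD}(x)` and
`Φ(f,g) = ¼ Σ_{a,b} Φ₈(f(· ‖ a ‖ b) ⊕ ab, E ⊕ QD ⊕ aQ ⊕ bD)`. [elementary character sums; S. Aaronson, A. Ambainis, *Forrelation*,
SIAM J. Comput. 47 (2018) §1.1.1 for the normalisation of `Φ`] -/
theorem stub_tenPeel :
    ∀ (E D Q : (Fin (4 + 4) → Bool) → Bool) (f g : (Fin (4 + 4 + 1 + 1) → Bool) → Bool),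
      (∀ (w : Fin (4 + 4) → Bool) (a b : Bool),
        g (Fin.snoc (Fin.snoc w a) b) = (E w ^^ (a && D w) ^^ (b && (a ^^ Q w)))) →
      (∀ (x : Fin (4 + 4) → Bool) (a b : Bool),
        W (fun y => signOf (g y)) (Fin.snoc (Fin.snoc x a) b) =
          2 * signOf (a && b) *
            W (fun w => signOf (E w ^^ (Q w && D w) ^^ (a && Q w) ^^ (b && D w))) x) ∧
      forrelation f g = (1 / 4) * ∑ a : Bool, ∑ b : Bool,
        forrelation (fun x : Fin (4 + 4) → Bool => f (Fin.snoc (Fin.snoc x a) b) ^^ (a && b))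
          (fun w => E w ^^ (Q w && D w) ^^ (a && Q w) ^^ (b && D w)) :=
  fun E D Q f g hg => ⟨tp_W_peel E D Q g hg, tp_forrelation_peel E D Q f g hg⟩

end Summit.QuantumAdvantage.QuantumAdvantage.Theorems.CubicForrelation.NearExactIsExact
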